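/-
Copyright: cell pub-balaban-gaps, seat ne8 (estimate NE7c), gen 12. Project licence.
-/
import Summits.QuantumFields.BalabanUV.T4Continuum.Spine.NE7b.NestedWindows

/-!
# Road (δ) on the NESTED WINDOWS of the 𝐑-step hierarchy: threshold nesting, separation and the relative large-field
# FLOOR letter `a = (λ∕2)·((1−θ)τ)²∕n` of `Spine/NE7b/NestedWindows` READ AT LIVE LETTERS (row NE7c; junction J-9)

Cell `pub-balaban-gaps` (G2), seat ne8, estimate **NE7c** (`T4IndicatorShell.ShellWeightBound`; two-run artefact, NOT PRINTED in
[Bałaban 1983–89], NOT PROVED).  Twenty-third proof-only file under `Spine/NE7c/`: seat ne6 gen 12's MODEL-level skeleton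
`Spine/NE7b/NestedWindows` (the refuter's ϝ-ne7bref-g70-1 display: «NE7b's sale» — the relative large-field gain `a` of the
fibrewise-relative compact-fibre carriers — needs print's THRESHOLD NESTING `θ < 1`; shape of [Balaban1989LargeFieldI]
(1.22)–(1.29)) consumed BY NAME; Mathlib + that file only; nothing of Bałaban's is named; no `def`; 0 `sorry`.

THE QUESTION (seat census `HOME/ne/NE7c.md`, NEW row 43).  Road (δ) = THRESHOLD RANDOMISATION of the background-mediated small-field
tests: member (δ-1) (`Literature…T4ShellMeasure` §8) multiplies EVERY live threshold of one comparison by ONE common factor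
`μ ∈ [λ₀, 1]`; members (δ-global) ∕ (δ-global-compact) (`LiveFactorGlobalLevels`, `LiveFactorGlobalCompact`) give each LEVEL its own
factor `μ_j ∈ [λ₀, 1]`, unordered.  `NestedWindows` has FOUR threshold-bearing letters: the NEW large-field threshold `τ`, the OLDER ∕
other small-field threshold `τ′`, the per-bond window `ρ`, and the centre's nesting depth `θ` («`w₀ ≤ θτ`» — the centre is the
minimiser controlled by the OLDER windows, so at live letters its bound carries the OLDER factor: `w₀ ≤ μ_c·θτ`).  What do the file's
three displays — NESTING (`obs_lt_of_nested` ∕ `window_subset_smallField` ∕ `disjoint_window_largeField`), SEPARATION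
(`sum_dev_ge_of_large` ∕ `sq_div_card_le_sum_sq_dev_of_large`) and the FLOOR (`floor_on_largeField` ∕ `hnum_of_nesting`) — cost at
live letters, and is the delivered floor letter assignment-free?

WHAT IS PROVED ([folklore]; every theorem is `NestedWindows` BY NAME at scaled letters plus one line of real arithmetic):
* §1 MEMBER (δ-1), ONE COMMON FACTOR `μ > 0` on `τ, τ′, ρ` and on the centre's bound: every display is HOMOGENEOUS — nesting
  closes under PRINT's clause `θτ + #s·ρ < τ′` verbatim (`obs_lt_of_nested_live_common`), the separation reads `(1−θ)·μτ ≤ ∑ d`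
  (`sum_dev_ge_of_large_live_common`) and its Cauchy–Schwarz currency `μ²·((1−θ)τ)²∕#s ≤ ∑ d²`, minorised by the ASSIGNMENT-FREE
  `λ₀²·((1−θ)τ)²∕#s` (`sq_div_card_le_sum_sq_dev_live_common`): the floor letter is LOSS × λ₀² — the class-C1 pattern of files 1 ∕ 15 ∕ 19
  (a large-field gain in an exponent at a lowered threshold), one constant for the grid.
* §2 LEVEL-WISE FACTORS (members (δ-global…)): new threshold and window at the booking level's factor `μ` (`λ₀ ≤ μ ≤ 1`), older
  threshold at `μ′ ≥ λ₀`, centre bound at `μ_c ≤ 1`.  NESTING INTO THE OLDER SET: with factors ORDERED younger ≤ older (`μ ≤ μ′`, and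
  `μ_c ≤ μ`) FREE (`obs_lt_of_nested_live_ordered`); UNORDERED it closes under print's clause WITH ROOM `λ₀`:
  `θτ + #s·ρ < λ₀·τ′` (`obs_lt_of_nested_live_levelwise`) — the pattern of file 12's `ineq38_live_levelwise` ([B14] (3.8), census
  row 28).  SEPARATION from the NEW event: the margin is `(μ − μ_cθ)τ` (`sum_dev_ge_of_large_live_levelwise`); ORDERED older ≤ younger
  (`μ_c ≤ μ`) it is `≥ λ₀(1−θ)τ` (LOSS × λ₀; `margin_live_ordered`), UNORDERED `≥ (λ₀ − θ)τ` — ROOM `θ ≤ λ₀` and margin EROSION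
  `(1−θ) ↦ (λ₀−θ)` (`margin_live_unordered`, `sq_div_card_le_sum_sq_dev_live_levelwise`).  The two nesting uses pull in OPPOSITE orders,
  so under unordered level-wise factors at least one ROOM clause is consumed; under (δ-1) none.
* §3 THE CORE AND THE FLOOR at live letters: `window_subset_smallField_live_common ∕ _levelwise`, `disjoint_window_largeField_live_common`,
  `floor_on_largeField_live_common` (`m₀ + λ₀²·(λ∕2)((1−θ)τ)²∕n ≤ I x` on the LIVE large-field event `{∃ p, μτ ≤ w p x}`, every
  `μ ≥ λ₀`), and the fibrewise **`hnum_of_nesting_live`** — VERBATIM the `hnum` hypothesis shape of `CompactFibreRelative.relFibre_moment_le`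
  with the ASSIGNMENT-FREE level `m y := m₀ y + λ₀²·a`, `a = (λ∕2)((1−θ)τ)²∕n`: ONE floor for the grid; `floor_on_largeField_live_levelwise`
  (margin `(λ₀ − θ)` in place of `(1 − θ)`).
* §4 reading aids (`floor_letter_live_four`: the live floor at `n = 4` is print's floor AT THE LOWERED THRESHOLD `λ₀τ`; `room_creation_half_iff`;
  `inherited_nesting_room` ∕ `_sharp`: the (1.22) ⟹ (1.3) shape «new `(1 − β∕2)E` implies inherited `E`» survives unordered level-wise factors
  iff `1 − β∕2 ≤ λ₀`, `= 3∕4` at print's `β = ½`) and a two-bond toy at `μ = 1∕2` (non-vacuity of the live letters).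

CENSUS (row 43, NEW; `HOME/ne/NE7c.md` §19): the nesting of thresholds within one 𝐑-step and against the inherited tests
([Balaban1989LargeFieldI] (1.22)–(1.24) ∕ (1.29), typed as printed in `B15SmallField185` ∕ `B15Claim129Step`) is, for road (δ), a SAME-STAGE
relation wherever the compared letters are booked at the same step (the sub-step ladder (1.23)–(1.24); at the CREATION step of [B15] pp. 193–195
the centre's bound (1.80) `(2 + r)ε_kη²` and the new threshold `3(1 − β∕2)ε_kη²` are both stage-`k` letters) — homogeneous under (δ-1) AND under
a factor assigned per booking stage: nesting FREE, floor LOSS × λ₀² — and a CROSS-LEVEL relation where an inherited test of an older stage or an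
older-booked centre letter is compared with a new threshold (the (1.29) implication for (1.3)–(1.8)): FREE under (δ-1), ordered FREE, unordered
ROOM `λ₀` (the class of census row 28, [B14] (3.8)).  BY VALUE (reading aid only, `room_creation_half_iff`): were the creation-step centre letter
older-booked, seat ne6 gen 13's `θ_c = 8∕9 + 4r∕9` at `β = ½` (INTENT I-gapsne6-g13-1, leaf-02 g129's R-3 number) would turn the ROOM clause
`θ_c < λ₀` into `r < (9λ₀ − 8)∕4`, non-empty iff `λ₀ > 8∕9`; which letters are booked at which stage is the (A3) ∕ (A1c) reading — NOT valued
here.  CONVENTION NOTE: the level-wise members attach one factor per LEVEL; under the junction of record's C-ρ-TOWER convention (files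
14∕16∕17: thresholds carried by the step maps `op_k`) a step's new tests carry the booking step's factor and the inherited-test implications
are cross-level (ROOM `1 − β∕2 ≤ λ₀`, `inherited_nesting_room`); were the factor attached to the threshold FAMILY `ε_h` instead, (1.22) and
(1.3) would share it and the row would be FREE under every member.  BY-NAME EFFECT ON THE WALL: none (junction ∕ census file).

NOT HERE (honest): which thresholds, windows and moduli print uses at a creation step, the value of `θ*`, that a convexity floor of modulus
`λ` holds out to the large-field event ((A3) ∕ (A1c) readings — `NestedWindows`' own HONEST REMARKS apply verbatim); Bałaban's
configurations; node O; NE7c.  VERDICT WORD UNCHANGED: WORK-bound behind node O; INSTANCE 0∕1.  NE7c ∕ NE7b NOT PRINTED ∕ NOT PROVED;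
spine 0∕9; one finite T⁴ — NOT ℝ⁴, NOT infinite volume, NOT the mass gap, NOT Clay.
HONEST DEPENDENCY (cell): continuum YM on T⁴ ⇐ BetaPertH ∧ nine spine estimates (0∕9 proved); BetaPertH ⇐ (D1) ∧ (D4) ∧ CAP+tail.
-/

set_option autoImplicit false

namespace Summit.QuantumFields.BalabanUV.T4Continuum.Spine.NE7c.LiveFactorNestedWindows

open Finset
open Summit.QuantumFields.BalabanUV.T4Continuum.NE7b.NestedWindows

/-! ## §1 Member (δ-1): ONE common factor — nesting FREE (homogeneous), separation and floor LOSS × λ₀² -/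

section Common

variable {B : Type*} {s : Finset B} {d : B → ℝ} {w w₀ θ τ τ' ρ μ lam0 : ℝ}

/-- **NESTING UNDER ONE COMMON LIVE FACTOR IS PRINT's NESTING** (homogeneity): new threshold `μτ`, older threshold `μτ′`, window `μρ`,
centre `θ`-deep in the LIVE new threshold (`w₀ ≤ θ·(μτ)`), `μ > 0`; then print's clause `θτ + #s·ρ < τ′` VERBATIM gives `w < μτ′` —
the older characteristic function at its live threshold is `1` on the live window. [folklore] -/
theorem obs_lt_of_nested_live_common (hLip : |w - w₀| ≤ ∑ b ∈ s, d b) (hwin : ∀ b ∈ s, d b ≤ μ * ρ)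
    (hcentre : w₀ ≤ θ * (μ * τ)) (hμ : 0 < μ) (hnest : θ * τ + s.card * ρ < τ') : w < μ * τ' := by
  refine obs_lt_of_nested (θ := θ) (τ := μ * τ) hLip hwin hcentre ?_
  have h : μ * (θ * τ + s.card * ρ) < μ * τ' := mul_lt_mul_of_pos_left hnest hμ
  calc θ * (μ * τ) + s.card * (μ * ρ) = μ * (θ * τ + s.card * ρ) := by ring
    _ < μ * τ' := h

/-- **SEPARATION UNDER ONE COMMON FACTOR**: a configuration large at the LIVE threshold (`μτ ≤ w`) over a centre `θ`-deep in it has total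
bond deviation `≥ (1 − θ)·μτ` — `NestedWindows.sum_dev_ge_of_large` at `τ := μτ`. [folklore] -/
theorem sum_dev_ge_of_large_live_common (hLip : |w - w₀| ≤ ∑ b ∈ s, d b) (hcentre : w₀ ≤ θ * (μ * τ))
    (hlarge : μ * τ ≤ w) : (1 - θ) * (μ * τ) ≤ ∑ b ∈ s, d b :=
  sum_dev_ge_of_large hLip hcentre hlarge

/-- **THE FLOOR CURRENCY UNDER ONE COMMON FACTOR: LOSS × λ₀², ASSIGNMENT-FREE.**  Cauchy–Schwarz at the live threshold gives
`((1−θ)μτ)²∕#s ≤ ∑ d²`, i.e. `μ²·((1−θ)τ)²∕#s ≤ ∑ d²`; for every factor `μ ≥ λ₀ ≥ 0` of the grid this is minorised by the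
assignment-free `λ₀²·((1−θ)τ)²∕#s` (print: `θτ ≤ τ`). [folklore] -/
theorem sq_div_card_le_sum_sq_dev_live_common (hs : s.Nonempty) (hLip : |w - w₀| ≤ ∑ b ∈ s, d b)
    (hcentre : w₀ ≤ θ * (μ * τ)) (hθτ : θ * τ ≤ τ) (hlarge : μ * τ ≤ w) (h0 : 0 ≤ lam0) (hμ : lam0 ≤ μ) :
    lam0 ^ 2 * (((1 - θ) * τ) ^ 2 / s.card) ≤ ∑ b ∈ s, d b ^ 2 := by
  have hμ0 : 0 ≤ μ := h0.trans hμ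
  have hθμτ : θ * (μ * τ) ≤ μ * τ := by
    have := mul_le_mul_of_nonneg_left hθτ hμ0
    linarith [this]
  have h := sq_div_card_le_sum_sq_dev_of_large hs hLip hcentre hθμτ hlarge
  have hsq : lam0 ^ 2 ≤ μ ^ 2 := pow_le_pow_left₀ h0 hμ 2
  have hnn : 0 ≤ ((1 - θ) * τ) ^ 2 / s.card := by positivity
  calc lam0 ^ 2 * (((1 - θ) * τ) ^ 2 / s.card) ≤ μ ^ 2 * (((1 - θ) * τ) ^ 2 / s.card) :=
        mul_le_mul_of_nonneg_right hsq hnn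
    _ = ((1 - θ) * (μ * τ)) ^ 2 / s.card := by ring
    _ ≤ ∑ b ∈ s, d b ^ 2 := h

end Common

/-! ## §2 Level-wise factors (members (δ-global) ∕ (δ-global-compact)): ordered FREE, unordered ROOM `λ₀` -/

section Levelwise

variable {B : Type*} {s : Finset B} {d : B → ℝ} {w w₀ θ τ τ' ρ μ μ' μc lam0 : ℝ}

/-- **NESTING INTO THE OLDER SET, FACTORS ORDERED younger ≤ older: FREE.**  New threshold and window at the booking level's factor `μ > 0`,
centre bound at `μ_c ≤ μ` (`w₀ ≤ μ_c·θτ`, `θτ ≥ 0`), older threshold at `μ′ ≥ μ` (`τ′ ≥ 0`): print's clause `θτ + #s·ρ < τ′` gives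
`w < μ′τ′`. [folklore] -/
theorem obs_lt_of_nested_live_ordered (hLip : |w - w₀| ≤ ∑ b ∈ s, d b) (hwin : ∀ b ∈ s, d b ≤ μ * ρ)
    (hcentre : w₀ ≤ μc * (θ * τ)) (hμc : μc ≤ μ) (hθτ : 0 ≤ θ * τ) (hμ : 0 < μ) (hμμ' : μ ≤ μ') (hτ' : 0 ≤ τ')
    (hnest : θ * τ + s.card * ρ < τ') : w < μ' * τ' := by
  have hcentre' : w₀ ≤ θ * (μ * τ) := by
    have := mul_le_mul_of_nonneg_right hμc hθτ
    linarith [this]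
  have h := obs_lt_of_nested_live_common hLip hwin hcentre' hμ hnest
  exact h.trans_le (mul_le_mul_of_nonneg_right hμμ' hτ')

/-- **NESTING INTO THE OLDER SET, FACTORS UNORDERED: ROOM `λ₀`.**  New threshold at `μ ≤ 1`, window at `μ_w ≤ 1` (`ρ ≥ 0`), centre bound
at `μ_c ≤ 1` (`θτ ≥ 0`), older threshold at `μ′ ≥ λ₀` (`τ′ ≥ 0`): the nesting closes under print's clause WITH ROOM `λ₀`,
`θτ + #s·ρ < λ₀·τ′` — the located numerical clause of census row 43 (the pattern of `LiveFactorCrossLevel.ineq38_live_levelwise`).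
[folklore] -/
theorem obs_lt_of_nested_live_levelwise {μw : ℝ} (hLip : |w - w₀| ≤ ∑ b ∈ s, d b) (hwin : ∀ b ∈ s, d b ≤ μw * ρ)
    (hμw : μw ≤ 1) (hρ : 0 ≤ ρ) (hcentre : w₀ ≤ μc * (θ * τ)) (hμc : μc ≤ 1) (hθτ : 0 ≤ θ * τ)
    (hμ' : lam0 ≤ μ') (hτ' : 0 ≤ τ') (hroom : θ * τ + s.card * ρ < lam0 * τ') : w < μ' * τ' := by
  have hw : w ≤ w₀ + s.card * (μw * ρ) := obs_le_of_window hLip hwin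
  have hwin' : (s.card : ℝ) * (μw * ρ) ≤ s.card * ρ := by
    have hc : (0 : ℝ) ≤ s.card := Nat.cast_nonneg _
    have : μw * ρ ≤ ρ := mul_le_of_le_one_left hρ hμw
    exact mul_le_mul_of_nonneg_left this hc
  have hc' : μc * (θ * τ) ≤ θ * τ := mul_le_of_le_one_left hθτ hμc
  have hlast : lam0 * τ' ≤ μ' * τ' := mul_le_mul_of_nonneg_right hμ' hτ'
  linarith

/-- **SEPARATION FROM THE NEW EVENT, LEVEL-WISE**: large at the live new threshold (`μτ ≤ w`), centre bound at the older factor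
(`w₀ ≤ μ_c·θτ`): the total deviation is `≥ (μ − μ_cθ)·τ`. [folklore] -/
theorem sum_dev_ge_of_large_live_levelwise (hLip : |w - w₀| ≤ ∑ b ∈ s, d b) (hcentre : w₀ ≤ μc * (θ * τ))
    (hlarge : μ * τ ≤ w) : (μ - μc * θ) * τ ≤ ∑ b ∈ s, d b := by
  have h := obs_le_add_sum_dev hLip
  linarith

/-- **THE MARGIN, ORDERED older ≤ younger (`μ_c ≤ μ`): LOSS × λ₀ only** — `(μ − μ_cθ)τ ≥ λ₀(1 − θ)τ` for `μ ≥ λ₀`, `0 ≤ θ`, `τ ≥ 0`.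
[folklore] -/
theorem margin_live_ordered (hμc : μc ≤ μ) (hμ : lam0 ≤ μ) (hθ0 : 0 ≤ θ) (hθ1 : θ ≤ 1) (hτ : 0 ≤ τ) :
    lam0 * ((1 - θ) * τ) ≤ (μ - μc * θ) * τ := by
  have h1 : lam0 * (1 - θ) ≤ μ * (1 - θ) := mul_le_mul_of_nonneg_right hμ (by linarith)
  have h2 : μc * θ ≤ μ * θ := mul_le_mul_of_nonneg_right hμc hθ0
  have h3 : lam0 * (1 - θ) ≤ μ - μc * θ := by nlinarith
  calc lam0 * ((1 - θ) * τ) = (lam0 * (1 - θ)) * τ := by ring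
    _ ≤ (μ - μc * θ) * τ := mul_le_mul_of_nonneg_right h3 hτ

/-- **THE MARGIN, UNORDERED (`μ_c ≤ 1`, `μ ≥ λ₀`): EROSION `(1 − θ) ↦ (λ₀ − θ)`** — `(μ − μ_cθ)τ ≥ (λ₀ − θ)τ` (`0 ≤ θ`, `τ ≥ 0`); useful
only under the ROOM clause `θ ≤ λ₀`. [folklore] -/
theorem margin_live_unordered (hμc : μc ≤ 1) (hμ : lam0 ≤ μ) (hθ0 : 0 ≤ θ) (hτ : 0 ≤ τ) :
    (lam0 - θ) * τ ≤ (μ - μc * θ) * τ := by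
  have h2 : μc * θ ≤ θ := mul_le_of_le_one_left hθ0 hμc
  exact mul_le_mul_of_nonneg_right (by linarith) hτ

/-- **THE FLOOR CURRENCY, LEVEL-WISE UNORDERED**: under the ROOM clause `θ ≤ λ₀` (and `μ_c ≤ 1`, `λ₀ ≤ μ`, `0 ≤ θ`, `0 ≤ τ`) the
Cauchy–Schwarz separation at the live new threshold is minorised by the assignment-free, ERODED `((λ₀ − θ)τ)²∕#s ≤ ∑ d²`. [folklore] -/
theorem sq_div_card_le_sum_sq_dev_live_levelwise (hs : s.Nonempty) (hLip : |w - w₀| ≤ ∑ b ∈ s, d b)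
    (hcentre : w₀ ≤ μc * (θ * τ)) (hμc : μc ≤ 1) (hμ : lam0 ≤ μ) (hθ0 : 0 ≤ θ) (hroom : θ ≤ lam0) (hτ : 0 ≤ τ)
    (hlarge : μ * τ ≤ w) : ((lam0 - θ) * τ) ^ 2 / s.card ≤ ∑ b ∈ s, d b ^ 2 := by
  have hcard : (0 : ℝ) < s.card := by exact_mod_cast hs.card_pos
  have hsep : (μ - μc * θ) * τ ≤ ∑ b ∈ s, d b := sum_dev_ge_of_large_live_levelwise hLip hcentre hlarge
  have hmar : (lam0 - θ) * τ ≤ (μ - μc * θ) * τ := margin_live_unordered hμc hμ hθ0 hτ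
  have h0 : 0 ≤ (lam0 - θ) * τ := mul_nonneg (by linarith) hτ
  have hsq : ((lam0 - θ) * τ) ^ 2 ≤ (∑ b ∈ s, d b) ^ 2 := pow_le_pow_left₀ h0 (hmar.trans hsep) 2
  have hcs : (∑ b ∈ s, d b) ^ 2 ≤ s.card * ∑ b ∈ s, d b ^ 2 := sq_sum_le_card_mul_sum_sq
  rw [div_le_iff₀ hcard]
  nlinarith [Finset.sum_nonneg (fun b _ => sq_nonneg (d b)) (s := s)]

end Levelwise

/-! ## §3 The core of plaquettes and the FLOOR letter at live letters -/

section Core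

variable {X P B : Type*} {C : Finset P} {bd : P → Finset B} {w : P → X → ℝ} {w₀ : P → ℝ} {dev : X → B → ℝ}
  {θ τ τ' ρ μ μ' μc lam0 : ℝ} {n : ℕ}

/-- **THE LIVE WINDOW LIES IN THE OLDER LIVE SMALL-FIELD SET, COMMON FACTOR** (`window_subset_smallField` at scaled letters): print's clause
`θτ + n·ρ < τ′` verbatim, `μ > 0`, `ρ ≥ 0`. [folklore] -/
theorem window_subset_smallField_live_common
    (hLip : ∀ p ∈ C, ∀ x, |w p x - w₀ p| ≤ ∑ b ∈ bd p, dev x b)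
    (hcentre : ∀ p ∈ C, w₀ p ≤ θ * (μ * τ)) (hcard : ∀ p ∈ C, (bd p).card ≤ n) (hρ : 0 ≤ ρ) (hμ : 0 < μ)
    (hnest : θ * τ + n * ρ < τ') :
    {x : X | ∀ p ∈ C, ∀ b ∈ bd p, dev x b ≤ μ * ρ} ⊆ {x : X | ∀ p ∈ C, w p x < μ * τ'} := by
  refine window_subset_smallField (θ := θ) (τ := μ * τ) hLip hcentre hcard (mul_nonneg hμ.le hρ) ?_
  have h : μ * (θ * τ + n * ρ) < μ * τ' := mul_lt_mul_of_pos_left hnest hμ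
  calc θ * (μ * τ) + n * (μ * ρ) = μ * (θ * τ + n * ρ) := by ring
    _ < μ * τ' := h

/-- **THE SAME, LEVEL-WISE UNORDERED: ROOM `λ₀`** — window at `μ_w ≤ 1`, centre bound at `μ_c ≤ 1`, older threshold at `μ′ ≥ λ₀`
(`τ′ ≥ 0`, `θτ ≥ 0`, `ρ ≥ 0`), clause `θτ + n·ρ < λ₀·τ′`. [folklore] -/
theorem window_subset_smallField_live_levelwise {μw : ℝ}
    (hLip : ∀ p ∈ C, ∀ x, |w p x - w₀ p| ≤ ∑ b ∈ bd p, dev x b)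
    (hcentre : ∀ p ∈ C, w₀ p ≤ μc * (θ * τ)) (hμc : μc ≤ 1) (hθτ : 0 ≤ θ * τ)
    (hcard : ∀ p ∈ C, (bd p).card ≤ n) (hρ : 0 ≤ ρ) (hμw : μw ≤ 1) (hμ' : lam0 ≤ μ') (hτ' : 0 ≤ τ')
    (hroom : θ * τ + n * ρ < lam0 * τ') :
    {x : X | ∀ p ∈ C, ∀ b ∈ bd p, dev x b ≤ μw * ρ} ⊆ {x : X | ∀ p ∈ C, w p x < μ' * τ'} := by
  intro x hx p hp
  have hn : ((bd p).card : ℝ) * ρ ≤ n * ρ := by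
    have : ((bd p).card : ℝ) ≤ n := by exact_mod_cast hcard p hp
    exact mul_le_mul_of_nonneg_right this hρ
  exact obs_lt_of_nested_live_levelwise (hLip p hp x) (hx p hp) hμw hρ (hcentre p hp) hμc hθτ hμ' hτ' (by linarith)

/-- **THE LIVE WINDOW DOES NOT MEET THE LIVE NEW LARGE-FIELD EVENT, COMMON FACTOR**: print's clause `θτ + n·ρ < τ` verbatim. [folklore] -/
theorem disjoint_window_largeField_live_common
    (hLip : ∀ p ∈ C, ∀ x, |w p x - w₀ p| ≤ ∑ b ∈ bd p, dev x b)
    (hcentre : ∀ p ∈ C, w₀ p ≤ θ * (μ * τ)) (hcard : ∀ p ∈ C, (bd p).card ≤ n) (hρ : 0 ≤ ρ) (hμ : 0 < μ)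
    (hnest : θ * τ + n * ρ < τ) :
    Disjoint {x : X | ∀ p ∈ C, ∀ b ∈ bd p, dev x b ≤ μ * ρ} {x : X | ∃ p ∈ C, μ * τ ≤ w p x} := by
  refine disjoint_window_largeField (θ := θ) (τ := μ * τ) hLip hcentre hcard (mul_nonneg hμ.le hρ) ?_
  have h : μ * (θ * τ + n * ρ) < μ * τ := mul_lt_mul_of_pos_left hnest hμ
  calc θ * (μ * τ) + n * (μ * ρ) = μ * (θ * τ + n * ρ) := by ring
    _ < μ * τ := h

variable {D2 I : X → ℝ} {m₀ lam : ℝ}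

/-- **THE FLOOR ON THE LIVE LARGE-FIELD EVENT, COMMON FACTOR: LOSS × λ₀², ASSIGNMENT-FREE.**  `NestedWindows.floor_on_largeField` at
`τ := μτ` gives `m₀ + (λ∕2)·((1−θ)μτ)²∕n ≤ I x`; for every grid factor `μ ≥ λ₀ ≥ 0` this yields the ONE floor
`m₀ + λ₀²·(λ∕2)((1−θ)τ)²∕n ≤ I x` on `{∃ p ∈ C, μτ ≤ w p x}`. [folklore] -/
theorem floor_on_largeField_live_common {S : Set X} (hlam : 0 ≤ lam)
    (hLip : ∀ p ∈ C, ∀ x, |w p x - w₀ p| ≤ ∑ b ∈ bd p, dev x b)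
    (hcentre : ∀ p ∈ C, w₀ p ≤ θ * (μ * τ)) (hθτ : θ * τ ≤ τ) (hne : ∀ p ∈ C, (bd p).Nonempty)
    (hcard : ∀ p ∈ C, (bd p).card ≤ n)
    (hD2 : ∀ p ∈ C, ∀ x, ∑ b ∈ bd p, dev x b ^ 2 ≤ D2 x)
    (hS : {x : X | ∃ p ∈ C, μ * τ ≤ w p x} ⊆ S) (hlow : ∀ x ∈ S, m₀ + lam / 2 * D2 x ≤ I x)
    (h0 : 0 ≤ lam0) (hμ : lam0 ≤ μ)
    {x : X} (hx : x ∈ {x : X | ∃ p ∈ C, μ * τ ≤ w p x}) :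
    m₀ + lam0 ^ 2 * (lam / 2 * (((1 - θ) * τ) ^ 2 / n)) ≤ I x := by
  have hμ0 : 0 ≤ μ := h0.trans hμ
  have hθμτ : θ * (μ * τ) ≤ μ * τ := by
    have := mul_le_mul_of_nonneg_left hθτ hμ0
    linarith [this]
  have h := floor_on_largeField (θ := θ) (τ := μ * τ) hlam hLip hcentre hθμτ hne hcard hD2 hS hlow hx
  have hsq : lam0 ^ 2 ≤ μ ^ 2 := pow_le_pow_left₀ h0 hμ 2
  have hnn : 0 ≤ lam / 2 * (((1 - θ) * τ) ^ 2 / n) := by positivity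
  have hmono : lam0 ^ 2 * (lam / 2 * (((1 - θ) * τ) ^ 2 / n)) ≤ μ ^ 2 * (lam / 2 * (((1 - θ) * τ) ^ 2 / n)) :=
    mul_le_mul_of_nonneg_right hsq hnn
  have heq : μ ^ 2 * (lam / 2 * (((1 - θ) * τ) ^ 2 / n)) = lam / 2 * (((1 - θ) * (μ * τ)) ^ 2 / n) := by ring
  linarith

/-- **THE `hnum` DISPLAY AT LIVE LETTERS, FIBREWISE, ASSIGNMENT-FREE** (verbatim the hypothesis shape of
`CompactFibreRelative.relFibre_moment_le` with `m y := m₀ y + λ₀²·(λ∕2)((1−θ)τ)²∕n`): for EVERY live factor `μ ≥ λ₀` of the grid, a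
numerator supported in the LIVE large-field event `{∃ p, μτ ≤ w p x}`, centres `θ`-deep in the live threshold wherever the weight is
live, and a per-fibre convexity floor of modulus `λ` out to that event give ONE relative floor `a_live = λ₀²·a` — LOSS × λ₀², the grid
served by one letter. [folklore] -/
theorem hnum_of_nesting_live {Y : Type*} {F : X → ℝ} {wgt : Y → ℝ} {I : X × Y → ℝ} {m₀ : Y → ℝ} {w₀ : Y → P → ℝ}
    {dev : Y → X → B → ℝ} {D2 : Y → X → ℝ} (hlam : 0 ≤ lam)
    (hLip : ∀ y, wgt y ≠ 0 → ∀ p ∈ C, ∀ x, |w p x - w₀ y p| ≤ ∑ b ∈ bd p, dev y x b)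
    (hcentre : ∀ y, wgt y ≠ 0 → ∀ p ∈ C, w₀ y p ≤ θ * (μ * τ)) (hθτ : θ * τ ≤ τ)
    (hne : ∀ p ∈ C, (bd p).Nonempty) (hcard : ∀ p ∈ C, (bd p).card ≤ n)
    (hD2 : ∀ y, ∀ p ∈ C, ∀ x, ∑ b ∈ bd p, dev y x b ^ 2 ≤ D2 y x)
    (hF : ∀ x, F x ≠ 0 → x ∈ {x : X | ∃ p ∈ C, μ * τ ≤ w p x})
    (hlow : ∀ y, wgt y ≠ 0 → ∀ x ∈ {x : X | ∃ p ∈ C, μ * τ ≤ w p x}, m₀ y + lam / 2 * D2 y x ≤ I (x, y))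
    (h0 : 0 ≤ lam0) (hμ : lam0 ≤ μ) :
    ∀ x y, F x ≠ 0 → wgt y ≠ 0 → m₀ y + lam0 ^ 2 * (lam / 2 * (((1 - θ) * τ) ^ 2 / n)) ≤ I (x, y) := by
  intro x y hFx hwy
  exact floor_on_largeField_live_common (S := {x : X | ∃ p ∈ C, μ * τ ≤ w p x}) (I := fun x => I (x, y)) hlam
    (hLip y hwy) (hcentre y hwy) hθτ hne hcard (hD2 y) subset_rfl (hlow y hwy) h0 hμ (hF x hFx)

/-- **THE FLOOR ON THE LIVE LARGE-FIELD EVENT, LEVEL-WISE UNORDERED: ROOM `θ ≤ λ₀`, ERODED MARGIN.**  Centre bound at the older factor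
`μ_c ≤ 1` (`w₀ ≤ μ_c·θτ`), new event at `μ ≥ λ₀`, `0 ≤ θ ≤ λ₀`, `τ ≥ 0`: `m₀ + (λ∕2)·((λ₀−θ)τ)²∕n ≤ I x` there. [folklore] -/
theorem floor_on_largeField_live_levelwise {S : Set X} (hlam : 0 ≤ lam)
    (hLip : ∀ p ∈ C, ∀ x, |w p x - w₀ p| ≤ ∑ b ∈ bd p, dev x b)
    (hcentre : ∀ p ∈ C, w₀ p ≤ μc * (θ * τ)) (hμc : μc ≤ 1) (hμ : lam0 ≤ μ) (hθ0 : 0 ≤ θ) (hroom : θ ≤ lam0)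
    (hτ : 0 ≤ τ) (hne : ∀ p ∈ C, (bd p).Nonempty) (hcard : ∀ p ∈ C, (bd p).card ≤ n)
    (hD2 : ∀ p ∈ C, ∀ x, ∑ b ∈ bd p, dev x b ^ 2 ≤ D2 x)
    (hS : {x : X | ∃ p ∈ C, μ * τ ≤ w p x} ⊆ S) (hlow : ∀ x ∈ S, m₀ + lam / 2 * D2 x ≤ I x)
    {x : X} (hx : x ∈ {x : X | ∃ p ∈ C, μ * τ ≤ w p x}) :
    m₀ + lam / 2 * (((lam0 - θ) * τ) ^ 2 / n) ≤ I x := by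
  obtain ⟨p, hp, hτp⟩ := hx
  have hsep : ((lam0 - θ) * τ) ^ 2 / (bd p).card ≤ ∑ b ∈ bd p, dev x b ^ 2 :=
    sq_div_card_le_sum_sq_dev_live_levelwise (hne p hp) (hLip p hp x) (hcentre p hp) hμc hμ hθ0 hroom hτ hτp
  have hcp : (0 : ℝ) < (bd p).card := by exact_mod_cast (hne p hp).card_pos
  have hcn : ((bd p).card : ℝ) ≤ n := by exact_mod_cast hcard p hp
  have hnum : 0 ≤ ((lam0 - θ) * τ) ^ 2 := sq_nonneg _
  have hD : ((lam0 - θ) * τ) ^ 2 / n ≤ D2 x :=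
    calc ((lam0 - θ) * τ) ^ 2 / n ≤ ((lam0 - θ) * τ) ^ 2 / (bd p).card := div_le_div_of_nonneg_left hnum hcp hcn
      _ ≤ ∑ b ∈ bd p, dev x b ^ 2 := hsep
      _ ≤ D2 x := hD2 p hp x
  have hl : lam / 2 * (((lam0 - θ) * τ) ^ 2 / n) ≤ lam / 2 * D2 x := mul_le_mul_of_nonneg_left hD (by positivity)
  linarith [hlow x (hS ⟨p, hp, hτp⟩)]

end Core

/-! ## §4 Reading aids and sanity -/

/-- By-value reading aid (pure arithmetic): at `n = 4` the live floor letter `λ₀²·(λ(1−θ)²τ²∕8)` IS print's floor letter at the LOWERED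
threshold `λ₀τ` — `λ(1−θ)²(λ₀τ)²∕8`. [folklore] -/
theorem floor_letter_live_four (lam θ τ lam0 : ℝ) :
    lam0 ^ 2 * (lam / 2 * (((1 - θ) * τ) ^ 2 / (4 : ℕ))) = lam * (1 - θ) ^ 2 * (lam0 * τ) ^ 2 / 8 := by
  push_cast
  ring

/-- By-value reading aid: the unordered level-wise margin `(λ₀ − θ)` equals the common-factor margin `λ₀(1 − θ)` minus the erosion
`θ(1 − λ₀)` — zero erosion iff `λ₀ = 1` (no randomisation) or `θ = 0` (centre at the identity). [folklore] -/
theorem margin_erosion (θ lam0 : ℝ) : lam0 - θ = lam0 * (1 - θ) - θ * (1 - lam0) := by ring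

/-- By-value reading aid (pure arithmetic; the letters are seat ne6 gen 13's creation-step ratio `θ_c = 8∕9 + 4r∕9` at print's `β = ½`, with
`r` the (1.80) tail — NOT valued here): the unordered level-wise ROOM clause `θ_c < λ₀` reads `r < (9λ₀ − 8)∕4`; it is EMPTY for
`λ₀ ≤ 8∕9` and under (δ-1) it is not needed at all. [folklore] -/
theorem room_creation_half_iff (r lam0 : ℝ) : 8 / 9 + 4 * r / 9 < lam0 ↔ r < (9 * lam0 - 8) / 4 := by
  constructor <;> intro h <;> linarith

/-- By-value reading aid (pure arithmetic; the shape of [Balaban1989LargeFieldI] p. 181 «the restrictions in the function (1.22) imply that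
the characteristic functions (1.3) … are equal to 1»: a NEW test `|u| < (1 − β∕2)·E` against an INHERITED test `|u| < E` on the same
variable): with the new test at a level factor `μ_k ≤ 1` and the inherited one at `μ_h ≥ λ₀`, the implication survives for EVERY unordered
pair iff the ROOM clause `1 − β∕2 ≤ λ₀` holds (`= 3∕4` at print's `β = ½`); under (δ-1) (`μ_k = μ_h`) no clause.  Which tests are booked
at which level is the (A3) reading — NOT valued here. [folklore] -/
theorem inherited_nesting_room {u E β μk μh lam0 : ℝ} (hE : 0 ≤ E) (hβ : 0 ≤ 1 - β / 2) (hroom : 1 - β / 2 ≤ lam0)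
    (hμk : μk ≤ 1) (hμh : lam0 ≤ μh) (hu : u < μk * ((1 - β / 2) * E)) : u < μh * E := by
  have h1 : μk * ((1 - β / 2) * E) ≤ (1 - β / 2) * E := mul_le_of_le_one_left (mul_nonneg hβ hE) hμk
  have h2 : (1 - β / 2) * E ≤ lam0 * E := mul_le_mul_of_nonneg_right hroom hE
  have h3 : lam0 * E ≤ μh * E := mul_le_mul_of_nonneg_right hμh hE
  linarith

/-- And the clause is SHARP for the implication uniformly in `u`: if `λ₀ < 1 − β∕2` then at `μ_k = 1`, `μ_h = λ₀`, `E = 1` the value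
`u = λ₀` passes the new test and fails the inherited one. [folklore] -/
theorem inherited_nesting_room_sharp {β lam0 : ℝ} (h : lam0 < 1 - β / 2) :
    ∃ u : ℝ, u < 1 * ((1 - β / 2) * 1) ∧ ¬ (u < lam0 * 1) :=
  ⟨lam0, by linarith, by simp⟩

/-- Toy instance at a live factor (two bonds, observable `w = d₁ + d₂`, centre value `0`, `θ = 0`, print threshold `τ = 1`, live factor
`μ = 1∕2`, `λ₀ = 1∕2`): a configuration large at the LIVE threshold (`w = 1∕2`) has `∑ d² ≥ λ₀²·(1²∕2) = 1∕8`, as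
`sq_div_card_le_sum_sq_dev_live_common` predicts (here with equality: `d₁ = d₂ = 1∕4`). -/
example : (1 / 2 : ℝ) ^ 2 * (((1 - (0 : ℝ)) * 1) ^ 2 / (({0, 1} : Finset ℕ).card)) ≤
    ∑ b ∈ ({0, 1} : Finset ℕ), (fun _ : ℕ => (1 / 4 : ℝ)) b ^ 2 := by
  refine sq_div_card_le_sum_sq_dev_live_common (w := 1 / 2) (w₀ := 0) (μ := 1 / 2) (by simp) ?_ (by norm_num)
    (by norm_num) (by norm_num) (by norm_num) le_rfl
  norm_num

end Summit.QuantumFields.BalabanUV.T4Continuum.Spine.NE7c.LiveFactorNestedWindows
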